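import Summits.ValiantsHypothesis.ValiantsHypothesis.Theorems.LacunarySymmetroidMatrixDescartesNsdPivotLoneLadder

/-!
# `MatrixDescartes` census — ROOT PERSISTENCE UNDER SMALL EXTRA LETTERS (alternation certificates survive), and the GENUINE
# all-`K` floors of the `(1 | K−1)` NSD rows (non-zero letters at pairwise distinct exponents)

HONEST FRAMING.  Cell `pub-symmetroid`, seat `val-sym-mdr-p2` (gen 28); helper file `--supports` the crux
`Theses.LacunarySymmetroid.MatrixDescartes` (OPEN), NO closure claim.  Reader's price on this seat's `…NsdPivotLoneLadder` (crit-5 g7, 2026-08-29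
15:01Z): its all-`K` floors pad the `K = 4` objects with ZERO letters at a REPEATED exponent — admissible in the class as typed, but not floors for
«genuine» `K`-letter rows (non-zero letters, pairwise distinct exponents); «a genuine non-zero-letter floor would need root persistence under small
rank-one perturbations».  This file supplies exactly that, once and for all pencils:
* **`alternation_persists` (PERSISTENCE LEMMA, every size `m`, every `K`, `K'`).**  If the pivot pencil `X^e J + ∑ₖ X^{dₖ} Pₖ` has a STRICT sign
  alternation of its determinant along `N + 1` increasing positive points (the census's certificate format, `Pivot.le_pivotPosRoots_of_certificate`),
  then for ANY extra exponents `d'` and ANY extra matrices `Q_j` there is `ε > 0` such that the pencil with the `K + K'` letters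
  `Fin.append P (ε • Q)` at exponents `Fin.append d d'` still has at least `N` positive roots.  Proof: at each certificate point the determinant of the
  padded pencil is a continuous function of `ε` (`Continuous.matrix_det`) equal to the original one at `ε = 0`; finitely many strict inequalities persist
  on a neighbourhood of `0` (`ContinuousAt.eventually_lt`, `Filter.eventually_all`, `Metric.eventually_nhds_iff`).
* **`exists_genuine_loneBelow_rankOne` / `seven_le_budget_genuine_loneBelow_rankOne`**: for every `K ≥ 4` there is a `(1 | K−1)` NSD pencil with `K`
  NON-ZERO rank-`≤ 1` letters at PAIRWISE DISTINCT exponents and `≥ 7` positive roots (the `K = 4` seven-object of `…NsdPivotLoneRankOneFourSeven` plus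
  `K − 4` letters `ε·e₂e₂ᵀ` at exponents `121, 122, …`); hence every budget valid for the genuine class is `≥ 7` — the honest floor behind
  `NsdLoneLadder.loneBelow_rankOne_bracket`.  `exists_genuine_loneBelow` / `eight_le_budget_genuine_loneBelow`: the same with the full-rank lone letter
  (`≥ 8`, from `…NsdPivotLoneFullRankFourEight`).
The upper ends of the brackets (`2K − 1`, `2K`) are unchanged (tree).  Nothing here bears on `MatrixDescartes` in its window, on `DoorA26` / `DoorA34`, on the
cell's registers beyond these sub-rows, or on `VP ≠ VNP`.

[folklore] continuity of the determinant in one real parameter at finitely many points; no definitions, no named facts.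
-/

-- `Summit.ValiantsHypothesis.ValiantsHypothesis.…` repeats a component by the D-0017 layout
-- (single-conjunct summit), which the `dupNamespace` linter flags; the name is mandated.
set_option linter.dupNamespace false

namespace Summit.ValiantsHypothesis.ValiantsHypothesis.Theorems.LacunarySymmetroidMatrixDescartes.Pivot.Persistence

open Polynomial Matrix Finset Filter Topology
open scoped BigOperators

/-! ## 1. The persistence lemma -/

/-- The padded pencil at a point `t`, as a function of the size `ε` of the extra letters: continuous. [folklore] -/
theorem continuous_det_padded {m K K' : ℕ} (e : ℕ) (d : Fin K → ℕ) (J : Matrix (Fin m) (Fin m) ℝ) (P : Fin K → Matrix (Fin m) (Fin m) ℝ)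
    (d' : Fin K' → ℕ) (Q : Fin K' → Matrix (Fin m) (Fin m) ℝ) (t : ℝ) :
    Continuous fun ε : ℝ => (t ^ e • J + ∑ k, t ^ (Fin.append d d' k) • (Fin.append P (fun j => ε • Q j) k)).det := by
  refine Continuous.matrix_det (continuous_const.add ?_)
  rw [show (fun ε : ℝ => ∑ k, t ^ (Fin.append d d' k) • (Fin.append P (fun j => ε • Q j) k))
      = fun ε : ℝ => (∑ k : Fin K, t ^ d k • P k) + ∑ j : Fin K', (t ^ d' j * ε) • Q j from ?_]
  · exact continuous_const.add (continuous_finsetSum _ fun j _ => (continuous_const.mul continuous_id).smul continuous_const)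
  funext ε
  rw [Fin.sum_univ_add]
  simp only [Fin.append_left, Fin.append_right, smul_smul]

/-- At `ε = 0` the padded pencil has the determinant of the original pencil. [folklore] -/
theorem det_padded_zero {m K K' : ℕ} (e : ℕ) (d : Fin K → ℕ) (J : Matrix (Fin m) (Fin m) ℝ) (P : Fin K → Matrix (Fin m) (Fin m) ℝ)
    (d' : Fin K' → ℕ) (Q : Fin K' → Matrix (Fin m) (Fin m) ℝ) (t : ℝ) :
    (t ^ e • J + ∑ k, t ^ (Fin.append d d' k) • (Fin.append P (fun j => (0 : ℝ) • Q j) k)).det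
      = (t ^ e • J + ∑ k, t ^ d k • P k).det := by
  congr 1
  rw [Fin.sum_univ_add]
  simp only [Fin.append_left, Fin.append_right, zero_smul, smul_zero, Finset.sum_const_zero, add_zero]

/-- **PERSISTENCE LEMMA.**  A strict alternation certificate of a pivot pencil along `N + 1` increasing positive points survives the addition of
`K'` arbitrary extra letters scaled by a sufficiently small `ε > 0`: the padded pencil has at least `N` positive roots. [folklore] -/
theorem alternation_persists {m K K' N : ℕ} (e : ℕ) (d : Fin K → ℕ) (J : Matrix (Fin m) (Fin m) ℝ) (P : Fin K → Matrix (Fin m) (Fin m) ℝ)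
    (d' : Fin K' → ℕ) (Q : Fin K' → Matrix (Fin m) (Fin m) ℝ)
    (τ : Fin (N + 1) → ℝ) (hτ : StrictMono τ) (hpos : ∀ j, 0 < τ j)
    (halt : ∀ j : Fin N, (τ j.castSucc ^ e • J + ∑ k, τ j.castSucc ^ d k • P k).det
        * (τ j.succ ^ e • J + ∑ k, τ j.succ ^ d k • P k).det < 0) :
    ∃ ε : ℝ, 0 < ε ∧ N ≤ pivotPosRoots e (Fin.append d d') J (Fin.append P (fun j => ε • Q j)) := by
  classical
  -- the padded determinant at the certificate points, as a function of `ε`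
  set g : Fin (N + 1) → ℝ → ℝ := fun i ε =>
    (τ i ^ e • J + ∑ k, τ i ^ (Fin.append d d' k) • (Fin.append P (fun j => ε • Q j) k)).det with hg
  have hcont : ∀ i, Continuous (g i) := fun i => continuous_det_padded e d J P d' Q (τ i)
  have h0 : ∀ i, g i 0 = (τ i ^ e • J + ∑ k, τ i ^ d k • P k).det := fun i => det_padded_zero e d J P d' Q (τ i)
  have hev : ∀ j : Fin N, ∀ᶠ ε in 𝓝 (0 : ℝ), g j.castSucc ε * g j.succ ε < 0 := by
    intro j
    have hc : ContinuousAt (fun ε => g j.castSucc ε * g j.succ ε) 0 := ((hcont _).mul (hcont _)).continuousAt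
    have h := hc.eventually_lt continuousAt_const (show g j.castSucc 0 * g j.succ 0 < (0 : ℝ) by rw [h0, h0]; exact halt j)
    exact h
  have hall : ∀ᶠ ε in 𝓝 (0 : ℝ), ∀ j : Fin N, g j.castSucc ε * g j.succ ε < 0 := eventually_all.mpr hev
  obtain ⟨δ, hδ, hball⟩ := Metric.eventually_nhds_iff.mp hall
  refine ⟨δ / 2, by linarith, ?_⟩
  have hin : dist (δ / 2) (0 : ℝ) < δ := by
    rw [Real.dist_eq, sub_zero, abs_of_pos (by linarith)]; linarith
  exact le_pivotPosRoots_of_certificate (f := fun t => (t ^ e • J + ∑ k, t ^ (Fin.append d d' k)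
      • (Fin.append P (fun j => (δ / 2) • Q j) k)).det) (fun t => rfl) τ hτ hpos (hball hin)

/-! ## 2. Genuine all-`K` floors of the `(1 | K−1)` NSD rows -/

/-- Injectivity of the padded exponents `[0, 7, 23, 120] ++ [121, 122, …]`. [bookkeeping] -/
theorem append_exponents_injective (n : ℕ) :
    Function.Injective (Fin.append (![0, 7, 23, 120] : Fin 4 → ℕ) (fun j : Fin n => 121 + (j : ℕ))) := by
  intro x y hxy
  induction x using Fin.addCases with
  | left i =>
    induction y using Fin.addCases with
    | left i' =>
      simp only [Fin.append_left] at hxy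
      congr 1
      fin_cases i <;> fin_cases i' <;> simp_all
    | right j' =>
      simp only [Fin.append_left, Fin.append_right] at hxy
      exfalso; fin_cases i <;> simp at hxy <;> omega
  | right j =>
    induction y using Fin.addCases with
    | left i' =>
      simp only [Fin.append_left, Fin.append_right] at hxy
      exfalso; fin_cases i' <;> simp at hxy <;> omega
    | right j' =>
      simp only [Fin.append_right] at hxy
      congr 1
      exact Fin.ext (by omega)

/-- The pad letter `ε • e₂e₂ᵀ` is positive semidefinite, non-zero and above the pivot exponent for `ε > 0`. [bookkeeping] -/
theorem pad_posSemidef {ε : ℝ} (hε : 0 < ε) : (ε • (!![(0 : ℝ), 0; 0, 1] : Matrix (Fin 2) (Fin 2) ℝ)).PosSemidef := by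
  have h : ε • (!![(0 : ℝ), 0; 0, 1] : Matrix (Fin 2) (Fin 2) ℝ) = !![(0 : ℝ), 0; 0, ε] := by
    ext i j; fin_cases i <;> fin_cases j <;> simp
  rw [h]
  exact PivotTwoFourWitness.posSemidef_two_of_entries _ _ _ le_rfl hε.le (by simp)

/-- **Genuine floor objects, rank-one lone letter.**  For every `n`, a `(1 | 3+n)` NSD pencil with `4 + n` NON-ZERO letters of rank `≤ 1`… (the lone one of
rank one, the three upper ones rank one, the pads `ε·e₂e₂ᵀ` rank one) at PAIRWISE DISTINCT exponents (`0 | 6 | 7, 23, 120, 121, 122, …`) and at least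
`7` positive roots. [folklore] -/
theorem exists_genuine_loneBelow_rankOne (n : ℕ) :
    ∃ (d : Fin (4 + n) → ℕ) (P : Fin (4 + n) → Matrix (Fin 2) (Fin 2) ℝ),
      Function.Injective d ∧ (∀ k, (P k).PosSemidef ∧ P k ≠ 0) ∧ d (Fin.castAdd n 0) < 6 ∧
      (∀ k, k ≠ Fin.castAdd n 0 → 6 < d k) ∧ (P (Fin.castAdd n 0)).det = 0 ∧
      7 ≤ pivotPosRoots 6 d (!![((-16777216) : ℝ), 0; 0, ((-16777216) : ℝ)] : Matrix (Fin 2) (Fin 2) ℝ) P := by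
  obtain ⟨ε, hε, hN⟩ := alternation_persists (N := 7) 6 (![0, 7, 23, 120] : Fin 4 → ℕ)
    (!![((-16777216) : ℝ), 0; 0, ((-16777216) : ℝ)] : Matrix (Fin 2) (Fin 2) ℝ)
    (![!![(3248752 : ℝ), (0 : ℝ); (0 : ℝ), (0 : ℝ)],
         !![(14356521 : ℝ), (26928423 : ℝ); (26928423 : ℝ), (50509449 : ℝ)],
         !![(262144 : ℝ), (22538240 : ℝ); (22538240 : ℝ), (1937760400 : ℝ)],
         !![(1760929 : ℝ), (124212508 : ℝ); (124212508 : ℝ), (8761708816 : ℝ)]] : Fin 4 → Matrix (Fin 2) (Fin 2) ℝ)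
    (fun j : Fin n => 121 + (j : ℕ)) (fun _ => (!![(0 : ℝ), 0; 0, 1] : Matrix (Fin 2) (Fin 2) ℝ))
    ![1 / 4, 1 / 2, 13 / 16, 7 / 8, 15 / 16, 1, 17 / 16, 3]
    (by
      refine Fin.strictMono_iff_lt_succ.2 fun j => ?_
      fin_cases j <;> simp only [Fin.castSucc_mk, Fin.succ_mk] <;> norm_num)
    (by intro j; fin_cases j <;> norm_num)
    (by
      intro j
      rw [NsdLoneRankOneFourSeven.eval_det, NsdLoneRankOneFourSeven.eval_det]
      fin_cases j <;> simp only [Fin.castSucc_mk, Fin.succ_mk] <;> norm_num)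
  refine ⟨_, _, append_exponents_injective n, fun k => ?_, ?_, fun k hk => ?_, ?_, hN⟩
  · induction k using Fin.addCases with
    | left i =>
      rw [Fin.append_left]
      refine ⟨NsdLoneRankOneFourSeven.P_posSemidef i, ?_⟩
      fin_cases i <;> (intro h; have := congrFun (congrFun h 0) 0) <;> norm_num at this
    | right j =>
      rw [Fin.append_right]
      refine ⟨pad_posSemidef hε, fun h => ?_⟩
      have := congrFun (congrFun h 1) 1
      simp at this
      exact hε.ne' this
  · have h0 : (Fin.castAdd n (0 : Fin 4)) = Fin.castAdd n 0 := rfl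
    rw [Fin.append_left]; simp
  · induction k using Fin.addCases with
    | left i =>
      rw [Fin.append_left]
      have hi : i ≠ 0 := fun h => hk (by rw [h])
      fin_cases i <;> simp_all
    | right j => rw [Fin.append_right]; omega
  · rw [Fin.append_left]; exact NsdLoneRankOneFourSeven.lone_det

/-- **GENUINE FLOOR, rank-one lone letter, every `K ≥ 4`: `7 ≤ B`** for every budget `B` valid on the `(1 | K−1)` NSD class RESTRICTED to pencils with
non-zero letters at pairwise distinct exponents. [folklore] -/
theorem seven_le_budget_genuine_loneBelow_rankOne {K B : ℕ} (hK : 4 ≤ K)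
    (h : ∀ (e : ℕ) (d : Fin K → ℕ) (J : Matrix (Fin 2) (Fin 2) ℝ) (P : Fin K → Matrix (Fin 2) (Fin 2) ℝ) (k₀ : Fin K),
        (-J).PosSemidef → Function.Injective d → (∀ k, (P k).PosSemidef ∧ P k ≠ 0) → d k₀ < e → (∀ k, k ≠ k₀ → e < d k) →
        (P k₀).det = 0 → pivotPosRoots e d J P ≤ B) : 7 ≤ B := by
  obtain ⟨n, rfl⟩ := Nat.exists_eq_add_of_le hK
  obtain ⟨d, P, hinj, hP, hbot, hup, hdet, h7⟩ := exists_genuine_loneBelow_rankOne n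
  exact h7.trans (h 6 d _ P _ NsdLoneRankOneSeven.neg_J_posSemidef hinj hP hbot hup hdet)

/-- **Genuine floor objects, free (full-rank) lone letter**: as above with the lone letter `diag(3248752, 1)` and at least `8` roots. [folklore] -/
theorem exists_genuine_loneBelow (n : ℕ) :
    ∃ (d : Fin (4 + n) → ℕ) (P : Fin (4 + n) → Matrix (Fin 2) (Fin 2) ℝ),
      Function.Injective d ∧ (∀ k, (P k).PosSemidef ∧ P k ≠ 0) ∧ d (Fin.castAdd n 0) < 6 ∧
      (∀ k, k ≠ Fin.castAdd n 0 → 6 < d k) ∧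
      8 ≤ pivotPosRoots 6 d (!![((-16777216) : ℝ), 0; 0, ((-16777216) : ℝ)] : Matrix (Fin 2) (Fin 2) ℝ) P := by
  obtain ⟨ε, hε, hN⟩ := alternation_persists (N := 8) 6 (![0, 7, 23, 120] : Fin 4 → ℕ)
    (!![((-16777216) : ℝ), 0; 0, ((-16777216) : ℝ)] : Matrix (Fin 2) (Fin 2) ℝ)
    (![!![(3248752 : ℝ), (0 : ℝ); (0 : ℝ), (1 : ℝ)],
         !![(14356521 : ℝ), (26928423 : ℝ); (26928423 : ℝ), (50509449 : ℝ)],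
         !![(262144 : ℝ), (22538240 : ℝ); (22538240 : ℝ), (1937760400 : ℝ)],
         !![(1760929 : ℝ), (124212508 : ℝ); (124212508 : ℝ), (8761708816 : ℝ)]] : Fin 4 → Matrix (Fin 2) (Fin 2) ℝ)
    (fun j : Fin n => 121 + (j : ℕ)) (fun _ => (!![(0 : ℝ), 0; 0, 1] : Matrix (Fin 2) (Fin 2) ℝ))
    ![1 / 16, 1 / 4, 1 / 2, 13 / 16, 7 / 8, 15 / 16, 1, 17 / 16, 3]
    (by
      refine Fin.strictMono_iff_lt_succ.2 fun j => ?_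
      fin_cases j <;> simp only [Fin.castSucc_mk, Fin.succ_mk] <;> norm_num)
    (by intro j; fin_cases j <;> norm_num)
    (by
      intro j
      rw [NsdLoneFullRankFourEight.eval_det, NsdLoneFullRankFourEight.eval_det]
      fin_cases j <;> simp only [Fin.castSucc_mk, Fin.succ_mk] <;> norm_num)
  refine ⟨_, _, append_exponents_injective n, fun k => ?_, ?_, fun k hk => ?_, hN⟩
  · induction k using Fin.addCases with
    | left i =>
      rw [Fin.append_left]
      refine ⟨NsdLoneFullRankFourEight.P_posSemidef i, ?_⟩
      fin_cases i <;> (intro h; have := congrFun (congrFun h 0) 0) <;> norm_num at this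
    | right j =>
      rw [Fin.append_right]
      refine ⟨pad_posSemidef hε, fun h => ?_⟩
      have := congrFun (congrFun h 1) 1
      simp at this
      exact hε.ne' this
  · rw [Fin.append_left]; simp
  · induction k using Fin.addCases with
    | left i =>
      rw [Fin.append_left]
      have hi : i ≠ 0 := fun h => hk (by rw [h])
      fin_cases i <;> simp_all
    | right j => rw [Fin.append_right]; omega

/-- **GENUINE FLOOR, free lone letter, every `K ≥ 4`: `8 ≤ B`.** [folklore] -/
theorem eight_le_budget_genuine_loneBelow {K B : ℕ} (hK : 4 ≤ K)
    (h : ∀ (e : ℕ) (d : Fin K → ℕ) (J : Matrix (Fin 2) (Fin 2) ℝ) (P : Fin K → Matrix (Fin 2) (Fin 2) ℝ) (k₀ : Fin K),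
        (-J).PosSemidef → Function.Injective d → (∀ k, (P k).PosSemidef ∧ P k ≠ 0) → d k₀ < e → (∀ k, k ≠ k₀ → e < d k) →
        pivotPosRoots e d J P ≤ B) : 8 ≤ B := by
  obtain ⟨n, rfl⟩ := Nat.exists_eq_add_of_le hK
  obtain ⟨d, P, hinj, hP, hbot, hup, h8⟩ := exists_genuine_loneBelow n
  exact h8.trans (h 6 d _ P _ NsdLoneRankOneSeven.neg_J_posSemidef hinj hP hbot hup)

end Summit.ValiantsHypothesis.ValiantsHypothesis.Theorems.LacunarySymmetroidMatrixDescartes.Pivot.Persistence
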